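import Literature.NumberTheory.Automorphic.UnitaryGroupAdelicDet
import Literature.NumberTheory.Automorphic.UnitaryGroupAdelicOneTorus
import Literature.NumberTheory.Automorphic.UnitaryGroupArchimedean
import Literature.NumberTheory.Automorphic.RelNormOneTorusArch
import HarnessLib

/-!
# The archimedean determinant `det_∞ : U(J)(E ⊗ ℝ) → U(1)(F ⊗ ℝ)` and its compatibility with `det` on `U(J)(𝔸_F)`

Setting of `UnitaryGroupAdelicDet` / `UnitaryGroupArchimedean`: `E/F` number fields, `c : E ≃ₐ[F] E`,
`J ∈ M_N(E)` with `det J ≠ 0`; `U(J)(𝔸_F) = adelic F E c N J ≤ GL_N(𝔸_E)`, its archimedean component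
`arch F E c N J ≤ GL_N(E ⊗ ℝ)` embedded by `archToAdelic : k ↦ (k, 1)`, the determinant
`adelicDet : U(J)(𝔸_F) →* U(1)(𝔸_F) = adelicOne F E c`, the archimedean torus
`relNormOneInfUnits F E ≤ (E_∞)ˣ` with `relNormOneInfToIdeles : y ↦ (y, 1)`. This file supplies the three
kernel facts that make characters `χ ∘ det` of `U(J)(𝔸_F)` computable on the archimedean component:

* `adelicDet_eq_of_coe_eq_conj` — **conjugation invariance across forms**: if `g' = A⁻¹ g A` in `GL_N(𝔸_E)`
  (`g ∈ U(J)(𝔸)`, `g' ∈ U(J')(𝔸)`, any `A`), then `det g' = det g` in `U(1)(𝔸_F)` (frame transports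
  `x ↦ g_𝔸⁻¹ x g_𝔸` between `U(H)` and `U(diag d)` do not change `det`);
* `det_ofInfinite` — **`det (k, 1) = (det k, 1)`**: `det (GLn.ofInfinite k)` is the archimedean idele
  `infiniteIdeles (det_∞ k)`, `det_∞ k := (ringEquiv_mixedSpace E)⁻¹ (det k) ∈ (E_∞)ˣ` (`archDetInf`); hence
  `infiniteIdeles (det_∞ k) = det (archToAdelic k) ∈ U(1)(𝔸_F)` (`infiniteIdeles_archDetInf`,
  `infiniteIdeles_archDetInf_mem_adelicOne`);
* for `[E : F] = 2`, `c ≠ 1` (so `U(1)(𝔸_F) = ker N_{E/F}`, `adelicOne_eq_relNormOneIdeles`):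
  `mem_relNormOneInfUnits_iff_infiniteIdeles_mem` (`y ∈ U(1)(F ⊗ ℝ) ↔ (y, 1) ∈ U(1)(𝔸_F)`, by injectivity of
  `y ↦ (y, 1)`), the homomorphism **`archDet : arch F E c N J →* relNormOneInfUnits F E`** and
  **`relNormOneInfToIdeles_archDet`**: `(det_∞ k, 1) = adelicOneEquivRelNormOne (det (archToAdelic k))`;
  CM specialisations `cmArchDet L N H hH`, `coe_cmArchDet`, `relNormOneInfToIdeles_cmArchDet`, `continuous_cmArchDet`.

References: [BorelJacquet1979, §4.1] (`G(𝔸) = G_∞ × G(𝔸_f)`, the archimedean component `g ↦ (g, 1)`);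
[Mok2014, §1 Notation p. 5] (`det : U_{E/F}(N) → U_{E/F}(1)`); [PlatonovRapinchuk1994, §6.2] (the norm-one
torus). KERNEL ONLY: 0 records, 0 named facts, 0 sorry. Model-construction cell pub-hodgecm, node W2-Kn: the
bridge asked by the `K_∞`-type census (the value of `(χ_V ∘ det) ⊠ (χ_W ∘ det)` on `K_∞ × 1` is `χ_V` at the
archimedean norm-one idele `det_∞ k`). Nothing here is a claim of the manuscripts adjudicated by that cell.
-/

set_option autoImplicit false

noncomputable section

open NumberField NumberField.mixedEmbedding

namespace Literature.NumberTheory.Automorphic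

namespace UnitaryGroup

/-! ## §1. Conjugation invariance of `det` across forms -/

section Conj

variable (F E : Type) [Field F] [Field E] [NumberField E] [Algebra F E] (c : E ≃ₐ[F] E)
variable (N : ℕ) {J J' : Matrix (Fin N) (Fin N) E}

/-- **`det (A⁻¹ g A) = det g` in `U(1)(𝔸_F)`**, for `g ∈ U(J)(𝔸_F)`, `g' ∈ U(J')(𝔸_F)` with `g' = A⁻¹ g A` in
`GL_N(𝔸_E)` (any `A`). [folklore] -/
theorem adelicDet_eq_of_coe_eq_conj (hJ : J.det ≠ 0) (hJ' : J'.det ≠ 0) (g : adelic F E c N J)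
    (g' : adelic F E c N J') (A : GL (Fin N) (AdeleRing (𝓞 E) E))
    (h : (g' : GL (Fin N) (AdeleRing (𝓞 E) E)) = A⁻¹ * g * A) :
    adelicDet F E c N J' hJ' g' = adelicDet F E c N J hJ g := by
  refine Subtype.ext ?_
  rw [coe_adelicDet, coe_adelicDet, h, map_mul, map_mul, map_inv, inv_mul_cancel_comm]

/-- the same with the conjugating element on the other side: `g' = A g A⁻¹`. [folklore] -/
theorem adelicDet_eq_of_coe_eq_conj' (hJ : J.det ≠ 0) (hJ' : J'.det ≠ 0) (g : adelic F E c N J)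
    (g' : adelic F E c N J') (A : GL (Fin N) (AdeleRing (𝓞 E) E))
    (h : (g' : GL (Fin N) (AdeleRing (𝓞 E) E)) = A * g * A⁻¹) :
    adelicDet F E c N J' hJ' g' = adelicDet F E c N J hJ g :=
  adelicDet_eq_of_coe_eq_conj F E c N hJ hJ' g g' A⁻¹ (by rw [h, inv_inv])

end Conj

/-! ## §2. `det (k, 1) = (det k, 1)`: the determinant of the archimedean component -/

section GLDet

variable (E : Type) [Field E] (N : ℕ)

/-- **`det_∞ : GL_N(E ⊗ ℝ) →* (E_∞)ˣ`**, `k ↦ (ringEquiv_mixedSpace E)⁻¹ (det k)` — the determinant of an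
archimedean matrix, read in the infinite-adele currency `(InfiniteAdeleRing E)ˣ`. [cite: BorelJacquet1979, §4.1] -/
def glDetInf : GL (Fin N) (mixedSpace E) →* (InfiniteAdeleRing E)ˣ :=
  (Units.map (InfiniteAdeleRing.ringEquiv_mixedSpace E).symm.toRingHom.toMonoidHom).comp
    Matrix.GeneralLinearGroup.det

/-- underlying element of `glDetInf k`. [folklore] -/
@[simp] theorem coe_glDetInf (k : GL (Fin N) (mixedSpace E)) :
    ((glDetInf E N k : (InfiniteAdeleRing E)ˣ) : InfiniteAdeleRing E) =
      (InfiniteAdeleRing.ringEquiv_mixedSpace E).symm (k : Matrix (Fin N) (Fin N) (mixedSpace E)).det :=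
  rfl

/-- `det_∞` is continuous. [folklore] -/
theorem continuous_glDetInf : Continuous (glDetInf E N) :=
  (Continuous.units_map _ (continuous_ringEquiv_mixedSpace_symm E)).comp Matrix.GeneralLinearGroup.continuous_det

variable [NumberField E]

/-- **`det (k, 1) = (det_∞ k, 1)`** in `𝔸_Eˣ`: the determinant of the archimedean embedding `GLn.ofInfinite k`
is the infinite idele of `det_∞ k`. [cite: BorelJacquet1979, §4.1] -/
theorem det_ofInfinite (k : GL (Fin N) (mixedSpace E)) :
    Matrix.GeneralLinearGroup.det (GLn.ofInfinite N E k) =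
      GaloisRepresentations.infiniteIdeles E (glDetInf E N k) := by
  refine Units.ext (Prod.ext ?_ ?_)
  · show adeleFst E ((GLn.ofInfinite N E k : GL (Fin N) (AdeleRing (𝓞 E) E)) :
        Matrix (Fin N) (Fin N) (AdeleRing (𝓞 E) E)).det =
      (InfiniteAdeleRing.ringEquiv_mixedSpace E).symm (k : Matrix (Fin N) (Fin N) (mixedSpace E)).det
    rw [RingHom.map_det, RingHom.mapMatrix_apply, map_fst_ofInfinite, ← RingHom.mapMatrix_apply,
      ← RingHom.map_det]
    rfl
  · show adeleSnd E ((GLn.ofInfinite N E k : GL (Fin N) (AdeleRing (𝓞 E) E)) :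
        Matrix (Fin N) (Fin N) (AdeleRing (𝓞 E) E)).det = 1
    rw [RingHom.map_det, RingHom.mapMatrix_apply, map_snd_ofInfinite, Matrix.det_one]

end GLDet

section Arch

variable (F E : Type) [Field F] [Field E] [Algebra F E] (c : E ≃ₐ[F] E)
variable (N : ℕ) (J : Matrix (Fin N) (Fin N) E)

/-- **`det_∞ : U(J)(E ⊗ ℝ) →* (E_∞)ˣ`** (restriction of `glDetInf`). [cite: BorelJacquet1979, §4.1] -/
def archDetInf : arch F E c N J →* (InfiniteAdeleRing E)ˣ :=
  (glDetInf E N).comp (arch F E c N J).subtype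

/-- underlying element of `archDetInf k`. [folklore] -/
@[simp] theorem coe_archDetInf (k : arch F E c N J) :
    ((archDetInf F E c N J k : (InfiniteAdeleRing E)ˣ) : InfiniteAdeleRing E) =
      (InfiniteAdeleRing.ringEquiv_mixedSpace E).symm
        ((k : GL (Fin N) (mixedSpace E)) : Matrix (Fin N) (Fin N) (mixedSpace E)).det :=
  rfl

/-- `archDetInf k = glDetInf k`. [folklore] -/
theorem archDetInf_apply (k : arch F E c N J) :
    archDetInf F E c N J k = glDetInf E N (k : GL (Fin N) (mixedSpace E)) := rfl

/-- `det_∞` on `U(J)(E ⊗ ℝ)` is continuous. [folklore] -/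
theorem continuous_archDetInf : Continuous (archDetInf F E c N J) :=
  (continuous_glDetInf E N).comp continuous_subtype_val

variable [NumberField F] [NumberField E]

/-- **`(det_∞ k, 1) = det (archToAdelic k)`** in `𝔸_Eˣ`. [cite: BorelJacquet1979, §4.1] -/
theorem infiniteIdeles_archDetInf (k : arch F E c N J) :
    GaloisRepresentations.infiniteIdeles E (archDetInf F E c N J k) =
      Matrix.GeneralLinearGroup.det (adelicVal F E c N J (archToAdelic F E c N J k)) := by
  rw [adelicVal_archToAdelic]
  exact (det_ofInfinite E N (k : GL (Fin N) (mixedSpace E))).symm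

/-- the same against `adelicDet`: `(det_∞ k, 1)` is the underlying idele of `adelicDet (archToAdelic k)`.
[folklore] -/
theorem infiniteIdeles_archDetInf_eq_coe_adelicDet (hJ : J.det ≠ 0) (k : arch F E c N J) :
    GaloisRepresentations.infiniteIdeles E (archDetInf F E c N J k) =
      ((adelicDet F E c N J hJ (archToAdelic F E c N J k) : adelicOne F E c) : (AdeleRing (𝓞 E) E)ˣ) := by
  rw [infiniteIdeles_archDetInf]
  rfl

/-- **`(det_∞ k, 1) ∈ U(1)(𝔸_F)`** for `k ∈ U(J)(E ⊗ ℝ)`, `det J ≠ 0`. [folklore] -/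
theorem infiniteIdeles_archDetInf_mem_adelicOne (hJ : J.det ≠ 0) (k : arch F E c N J) :
    GaloisRepresentations.infiniteIdeles E (archDetInf F E c N J k) ∈ adelicOne F E c := by
  rw [infiniteIdeles_archDetInf_eq_coe_adelicDet F E c N J hJ]
  exact (adelicDet F E c N J hJ (archToAdelic F E c N J k)).2

end Arch

/-! ## §3. The quadratic case: `det_∞ : U(J)(E ⊗ ℝ) →* U(1)(F ⊗ ℝ) = relNormOneInfUnits F E` -/

section Quadratic

variable (F E : Type) [Field F] [Field E] [NumberField E] [Algebra F E] (c : E ≃ₐ[F] E)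
variable [FiniteDimensional F E]

/-- **`y ∈ U(1)(F ⊗ ℝ) ↔ (y, 1) ∈ U(1)(𝔸_F)`** (idele currency on both sides): the archimedean idele map
intertwines the two Galois norms and is injective. [folklore] -/
theorem mem_relNormOneInfUnits_iff_infiniteIdeles_mem (y : (InfiniteAdeleRing E)ˣ) :
    y ∈ relNormOneInfUnits F E ↔ GaloisRepresentations.infiniteIdeles E y ∈ relNormOneIdeles F E := by
  rw [mem_relNormOneInfUnits_iff, mem_relNormOneIdeles_iff, ← infiniteIdeles_infIdeleGalNorm]
  constructor
  · intro h
    rw [h, map_one]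
  · intro h
    exact infiniteIdeles_injective (h.trans (map_one _).symm)

variable [NumberField F] (N : ℕ) (J : Matrix (Fin N) (Fin N) E)

/-- for `[E : F] = 2`, `c ≠ 1`, `det J ≠ 0`: `det_∞ k ∈ U(1)(F ⊗ ℝ)` for `k ∈ U(J)(E ⊗ ℝ)`. [folklore] -/
theorem archDetInf_mem_relNormOneInfUnits (h2 : Module.finrank F E = 2) (hc : c ≠ 1) (hJ : J.det ≠ 0)
    (k : arch F E c N J) : archDetInf F E c N J k ∈ relNormOneInfUnits F E := by
  rw [mem_relNormOneInfUnits_iff_infiniteIdeles_mem, ← mem_adelicOne_iff_mem_relNormOneIdeles F E c h2 hc]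
  exact infiniteIdeles_archDetInf_mem_adelicOne F E c N J hJ k

/-- **`det_∞ : U(J)(E ⊗ ℝ) →* U(1)(F ⊗ ℝ)`** for `[E : F] = 2`, `c ≠ 1`, `det J ≠ 0`.
[cite: Mok2014, §1 Notation p. 5] -/
def archDet (h2 : Module.finrank F E = 2) (hc : c ≠ 1) (hJ : J.det ≠ 0) :
    arch F E c N J →* relNormOneInfUnits F E :=
  (archDetInf F E c N J).codRestrict (relNormOneInfUnits F E)
    fun k => archDetInf_mem_relNormOneInfUnits F E c N J h2 hc hJ k

/-- underlying unit of `archDet k`: `det_∞ k`. [folklore] -/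
@[simp] theorem coe_archDet (h2 : Module.finrank F E = 2) (hc : c ≠ 1) (hJ : J.det ≠ 0) (k : arch F E c N J) :
    ((archDet F E c N J h2 hc hJ k : relNormOneInfUnits F E) : (InfiniteAdeleRing E)ˣ) = archDetInf F E c N J k :=
  rfl

/-- `archDet` is continuous. [folklore] -/
theorem continuous_archDet (h2 : Module.finrank F E = 2) (hc : c ≠ 1) (hJ : J.det ≠ 0) :
    Continuous (archDet F E c N J h2 hc hJ) :=
  (continuous_archDetInf F E c N J).subtype_mk _

/-- **THE BRIDGE `(det_∞ k, 1) = det (k, 1)`** in the torus currency: the archimedean norm-one idele of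
`det_∞ k` is the image under `U(1)(𝔸_F) = ker N_{E/F}` (`adelicOneEquivRelNormOne`) of `det (archToAdelic k)`.
[cite: BorelJacquet1979, §4.1] -/
theorem relNormOneInfToIdeles_archDet (h2 : Module.finrank F E = 2) (hc : c ≠ 1) (hJ : J.det ≠ 0)
    (k : arch F E c N J) :
    relNormOneInfToIdeles F E (archDet F E c N J h2 hc hJ k) =
      adelicOneEquivRelNormOne F E c h2 hc (adelicDet F E c N J hJ (archToAdelic F E c N J k)) := by
  refine Subtype.ext ?_
  rw [coe_relNormOneInfToIdeles, coe_adelicOneEquivRelNormOne, coe_archDet,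
    infiniteIdeles_archDetInf_eq_coe_adelicDet F E c N J hJ]

end Quadratic

/-! ## §4. The CM case `E = L`, `F = L⁺`, `c` = complex conjugation -/

section CM

variable (L : Type) [Field L] [NumberField L] [IsCMField L]
variable (N : ℕ) (H : Matrix (Fin N) (Fin N) L)

/-- **`det_∞ : U(H)(L ⊗ ℝ) →* U(1)(L⁺ ⊗ ℝ) = relNormOneInfUnits L⁺ L`** (CM case, `det H ≠ 0`): `archDet` at the CM
pin `F = L⁺`, `E = L`, `c = complexConj L`, the quadratic hypotheses discharged by the tree's
`Algebra.IsQuadraticExtension.finrank_eq_two L⁺ L` (`h2`) and `IsCMField.complexConj_ne_one` (`hc`) — so every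
`archDet` lemma specialises by `exact`/`simpa` (see `relNormOneInfToIdeles_cmArchDet`). [cite: Mok2014, §1 Notation p. 5] -/
def cmArchDet (hH : H.det ≠ 0) :
    arch (↥(maximalRealSubfield L)) L (IsCMField.complexConj L) N H →* relNormOneInfUnits (↥(maximalRealSubfield L)) L :=
  archDet (↥(maximalRealSubfield L)) L (IsCMField.complexConj L) N H
    (Algebra.IsQuadraticExtension.finrank_eq_two _ L) (IsCMField.complexConj_ne_one (K := L)) hH

/-- underlying unit of `cmArchDet k`: `det_∞ k = (ringEquiv_mixedSpace L)⁻¹ (det k)`. [folklore] -/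
@[simp] theorem coe_cmArchDet (hH : H.det ≠ 0)
    (k : arch (↥(maximalRealSubfield L)) L (IsCMField.complexConj L) N H) :
    ((cmArchDet L N H hH k : relNormOneInfUnits (↥(maximalRealSubfield L)) L) : (InfiniteAdeleRing L)ˣ) =
      archDetInf (↥(maximalRealSubfield L)) L (IsCMField.complexConj L) N H k :=
  rfl

/-- underlying element of `L_∞` of `cmArchDet k`. [folklore] -/
theorem coe_coe_cmArchDet (hH : H.det ≠ 0)
    (k : arch (↥(maximalRealSubfield L)) L (IsCMField.complexConj L) N H) :
    (((cmArchDet L N H hH k : relNormOneInfUnits (↥(maximalRealSubfield L)) L) : (InfiniteAdeleRing L)ˣ) :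
        InfiniteAdeleRing L) =
      (InfiniteAdeleRing.ringEquiv_mixedSpace L).symm
        ((k : GL (Fin N) (mixedSpace L)) : Matrix (Fin N) (Fin N) (mixedSpace L)).det :=
  rfl

/-- `cmArchDet` is continuous. [folklore] -/
theorem continuous_cmArchDet (hH : H.det ≠ 0) : Continuous (cmArchDet L N H hH) :=
  continuous_archDet _ L _ N H _ _ hH

/-- **THE CM BRIDGE**: `(det_∞ k, 1) = cmAdelicOneEquivRelNormOne (det (archToAdelic k))` in
`U(1)(𝔸_{L⁺}) = relNormOneIdeles L⁺ L`. [cite: BorelJacquet1979, §4.1] -/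
theorem relNormOneInfToIdeles_cmArchDet (hH : H.det ≠ 0)
    (k : arch (↥(maximalRealSubfield L)) L (IsCMField.complexConj L) N H) :
    relNormOneInfToIdeles (↥(maximalRealSubfield L)) L (cmArchDet L N H hH k) =
      cmAdelicOneEquivRelNormOne L
        (adelicDet (↥(maximalRealSubfield L)) L (IsCMField.complexConj L) N H hH
          (archToAdelic (↥(maximalRealSubfield L)) L (IsCMField.complexConj L) N H k)) :=
  relNormOneInfToIdeles_archDet _ L _ N H _ _ hH k

/-- the CM bridge read through any homomorphism out of the torus (e.g. the quotient map to `[U(1)]` followed by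
a character): `f (det_∞ k, 1) = f (cmAdelicOneEquivRelNormOne (det (k, 1)))`. [folklore] -/
theorem apply_relNormOneInfToIdeles_cmArchDet {A : Type} [Monoid A] (hH : H.det ≠ 0)
    (f : relNormOneIdeles (↥(maximalRealSubfield L)) L →* A)
    (k : arch (↥(maximalRealSubfield L)) L (IsCMField.complexConj L) N H) :
    f (relNormOneInfToIdeles (↥(maximalRealSubfield L)) L (cmArchDet L N H hH k)) =
      f (cmAdelicOneEquivRelNormOne L
        (adelicDet (↥(maximalRealSubfield L)) L (IsCMField.complexConj L) N H hH
          (archToAdelic (↥(maximalRealSubfield L)) L (IsCMField.complexConj L) N H k))) := by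
  rw [relNormOneInfToIdeles_cmArchDet]

end CM

end UnitaryGroup

end Literature.NumberTheory.Automorphic

end
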